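import Mathlib
import Summits.RiemannHypothesis.RiemannHypothesis.Theorems.WeilFarFloorCoshCouplingRH
import Summits.RiemannHypothesis.RiemannHypothesis.Theorems.WeilFarFloorCouplingTransfer
import Summits.RiemannHypothesis.RiemannHypothesis.Theorems.WeilFarFloorFormPolarization
import HarnessLib

/-!
# The residual energy of the cosh profile: projection minimality (RH-free) and the von Koch bound (RH)

Helper file (`--supports stmt-RiemannHypothesis-0098`, lead-track anchor: Weil-positivity window ladder, format-C far bound),
pure proofs over BUILT imports.  Seat rh-explicit-weil-1 gen15 (memo `run/shared/lean/pub/rh-explicit/rh-explicit-weil-1/FORMAT-K3.md`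
§16).

`C_b = 1_{[−b,b]}cosh(·/2)` (`P = ∫C_b² = b + sinh b`), `T_b` the prime-shift operator, `R_c(b) = Q_b(C_b)/P` the cosh quotient,
and the RESIDUAL ENERGY `ρ(b) = ∫_{(−b,b)} (T_bC_b − R_c(b)C_b)²` (`J(b) = ρ(b)/P`, the second-order coefficient of the floor gap,
`WeilFarFloorSecondOrderLawRH`).

* §1 (RH-free) `setIntegral_primeShiftOp_sub_sq_eq`: for every real `λ`,
  `∫_{(−b,b)}(T_bC_b − λC_b)² = ρ(b) + (λ − R_c(b))²·P` — `R_cC_b` is the orthogonal projection of `T_bC_b` onto the profile inside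
  the window (`∫(T_bC_b)C_b = Q_b(C_b)`), so EVERY coupling budget of the rate files bounds the residual energy
  (`setIntegral_residual_sq_le`).
* §2 (RH) `residualEnergy_le_of_RH`: `RH → ∃ K > 0, ∀ b ≥ 1, ρ(b) ≤ K·b⁵·(b + sinh b)` — from the stage-1 coupling
  `WeilFarFloorCoshCouplingRH.integral_primeShiftOp_coshProfile_sub_sq_le_of_RH` (`λ = e^b + b`, von Koch); so `J(b) ≤ K b⁵` and the
  second-order law contains C-XIII″ with the rate `(a+2)⁵e^{−a}` (`WeilFarFloorCoshGapRateRH`).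
Standard axioms only; RH enters §2 as Mathlib's `RiemannHypothesis`.  Nothing here bears on the truth of RH.
-/

set_option linter.dupNamespace false
set_option autoImplicit false

noncomputable section

open MeasureTheory Set Filter
open scoped Real Topology ArithmeticFunction.vonMangoldt

namespace Summit.RiemannHypothesis.RiemannHypothesis.Theorems.WeilFormatC

namespace FloorCoshSplit

open Literature.NumberTheory.LFunctions FloorCosh

variable {b : ℝ}

/-! ## §1 Projection minimality (RH-free) -/

/-- **The coupling budget at `λ` exceeds the residual energy by exactly `(λ − R_c)²·P`.**  For `b > 0` and every real `λ`:
`∫_{(−b,b)}(T_bC_b − λC_b)² = ∫_{(−b,b)}(T_bC_b − R_c(b)C_b)² + (λ − R_c(b))²·(b + sinh b)`. -/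
theorem setIntegral_primeShiftOp_sub_sq_eq (hb : 0 < b) (lam : ℝ) :
    ∫ x in Ioo (-b) b, ((∑ n ∈ weilPrimeIndex b, (Λ n : ℝ) / Real.sqrt n *
        ((Icc (-b) b).indicator (fun y ↦ Real.cosh (y / 2)) (x - Real.log n)
          + (Icc (-b) b).indicator (fun y ↦ Real.cosh (y / 2)) (x + Real.log n)))
        - lam * (Icc (-b) b).indicator (fun y ↦ Real.cosh (y / 2)) x) ^ 2
      = (∫ x in Ioo (-b) b, ((∑ n ∈ weilPrimeIndex b, (Λ n : ℝ) / Real.sqrt n *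
          ((Icc (-b) b).indicator (fun y ↦ Real.cosh (y / 2)) (x - Real.log n)
            + (Icc (-b) b).indicator (fun y ↦ Real.cosh (y / 2)) (x + Real.log n)))
          - primeShiftForm b ((Icc (-b) b).indicator (fun y ↦ Real.cosh (y / 2))) / (b + Real.sinh b)
            * (Icc (-b) b).indicator (fun y ↦ Real.cosh (y / 2)) x) ^ 2)
        + (lam - primeShiftForm b ((Icc (-b) b).indicator (fun y ↦ Real.cosh (y / 2))) / (b + Real.sinh b)) ^ 2
          * (b + Real.sinh b) := by
  obtain ⟨hCm, hCb, hCs⟩ := coshTest_admissible b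
  set C : ℝ → ℝ := (Icc (-b) b).indicator (fun y ↦ Real.cosh (y / 2)) with hCdef
  set P := b + Real.sinh b with hP
  have hP0 : 0 < P := by have := Real.sinh_pos_iff.2 hb; rw [hP]; linarith
  set R := primeShiftForm b C / P with hR
  set F : ℝ → ℝ := fun x ↦ ∑ n ∈ weilPrimeIndex b, (Λ n : ℝ) / Real.sqrt n * (C (x - Real.log n) + C (x + Real.log n))
    with hF
  have hFm : Measurable F := measurable_primeShiftOp hCm
  have hFb : ∀ x, |F x| ≤ 2 * (∑ n ∈ weilPrimeIndex b, (Λ n : ℝ) / Real.sqrt n) * Real.cosh (b / 2) :=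
    fun x ↦ abs_primeShiftOp_le hCb x
  -- integrability on the window of the bounded measurable pieces
  have hvol : volume (Ioo (-b) b) < ⊤ := measure_Ioo_lt_top
  have hint : ∀ {g : ℝ → ℝ} {M : ℝ}, Measurable g → (∀ x, |g x| ≤ M) → IntegrableOn g (Ioo (-b) b) := by
    intro g M hg hM
    exact Measure.integrableOn_of_bounded (M := M) hvol.ne hg.aestronglyMeasurable
      (Eventually.of_forall fun x ↦ by rw [Real.norm_eq_abs]; exact hM x)
  have hCF : ∀ x, |C x * F x| ≤ Real.cosh (b / 2) * (2 * (∑ n ∈ weilPrimeIndex b, (Λ n : ℝ) / Real.sqrt n) * Real.cosh (b / 2)) :=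
    fun x ↦ by rw [abs_mul]; exact mul_le_mul (hCb x) (hFb x) (abs_nonneg _) (Real.cosh_pos _).le
  have hCC : ∀ x, |C x * C x| ≤ Real.cosh (b / 2) * Real.cosh (b / 2) :=
    fun x ↦ by rw [abs_mul]; exact mul_le_mul (hCb x) (hCb x) (abs_nonneg _) (Real.cosh_pos _).le
  have iCF : IntegrableOn (fun x ↦ C x * F x) (Ioo (-b) b) := hint (hCm.mul hFm) hCF
  have iCC : IntegrableOn (fun x ↦ C x * C x) (Ioo (-b) b) := hint (hCm.mul hCm) hCC
  have hres : ∀ x, |F x - R * C x| ≤ 2 * (∑ n ∈ weilPrimeIndex b, (Λ n : ℝ) / Real.sqrt n) * Real.cosh (b / 2)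
      + |R| * Real.cosh (b / 2) := fun x ↦ by
    refine (abs_sub _ _).trans (add_le_add (hFb x) ?_)
    rw [abs_mul]; exact mul_le_mul_of_nonneg_left (hCb x) (abs_nonneg _)
  have iRR : IntegrableOn (fun x ↦ (F x - R * C x) ^ 2) (Ioo (-b) b) := by
    refine hint ((hFm.sub (hCm.const_mul R)).pow_const 2) (M := (2 * (∑ n ∈ weilPrimeIndex b,
      (Λ n : ℝ) / Real.sqrt n) * Real.cosh (b / 2) + |R| * Real.cosh (b / 2)) ^ 2) fun x ↦ ?_
    rw [abs_pow]; exact pow_le_pow_left₀ (abs_nonneg _) (hres x) 2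
  have iRC : IntegrableOn (fun x ↦ C x * (F x - R * C x)) (Ioo (-b) b) := by
    have e : (fun x ↦ C x * (F x - R * C x)) = fun x ↦ C x * F x - R * (C x * C x) := funext fun x ↦ by ring
    rw [e]; exact iCF.sub (iCC.const_mul R)
  -- the window integrals of `C·F` and `C²` are the whole-line ones
  have hIcc : ∀ g : ℝ → ℝ, ∫ x in Ioo (-b) b, C x * g x = ∫ x, C x * g x := fun g ↦ by
    rw [setIntegral_congr_set Ioo_ae_eq_Icc]
    exact setIntegral_eq_integral_of_forall_compl_eq_zero fun x hx ↦ by rw [hCs x hx, zero_mul]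
  have hQF : ∫ x, C x * F x = R * P := by
    have h := bilinear_eq_integral_primeShiftOp_mul (b := b) hCm hCm hCb hCb hCs
    have e : ∑ n ∈ weilPrimeIndex b, 2 * ((Λ n : ℝ) / Real.sqrt n) *
        ((∫ x, C (x - Real.log n) * C x) + ∫ x, C (x - Real.log n) * C x) = 2 * primeShiftForm b C := by
      unfold primeShiftForm; rw [Finset.mul_sum]; exact Finset.sum_congr rfl fun n _ ↦ by ring
    rw [e] at h
    have h2 : ∫ x, C x * F x = ∫ x, F x * C x := integral_congr_ae (Eventually.of_forall fun x ↦ mul_comm _ _)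
    rw [h2, hR, div_mul_cancel₀ _ hP0.ne']
    simp only [hF] at h ⊢; linarith only [h]
  have hCC' : ∫ x, C x * C x = P := by
    rw [hP, ← integral_coshTest_sq hb.le]
    exact integral_congr_ae (Eventually.of_forall fun x ↦ by simp only [hCdef]; ring)
  -- orthogonality inside the window
  have horth : ∫ x in Ioo (-b) b, C x * (F x - R * C x) = 0 := by
    have e : (fun x ↦ C x * (F x - R * C x)) = fun x ↦ C x * F x - R * (C x * C x) := funext fun x ↦ by ring
    rw [e, integral_sub iCF (iCC.const_mul R), integral_const_mul, hIcc F, hIcc C, hQF, hCC']; ring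
  have hCCw : ∫ x in Ioo (-b) b, C x * C x = P := by rw [hIcc C, hCC']
  -- expand `(F − λC)² = (F − RC)² + (λ−R)²C² − 2(λ−R)·C(F − RC)`
  have e : (fun x ↦ (F x - lam * C x) ^ 2)
      = fun x ↦ (F x - R * C x) ^ 2 + (lam - R) ^ 2 * (C x * C x) - 2 * (lam - R) * (C x * (F x - R * C x)) :=
    funext fun x ↦ by ring
  show ∫ x in Ioo (-b) b, (F x - lam * C x) ^ 2 = (∫ x in Ioo (-b) b, (F x - R * C x) ^ 2) + (lam - R) ^ 2 * P
  have i1 : IntegrableOn (fun x ↦ (F x - R * C x) ^ 2 + (lam - R) ^ 2 * (C x * C x)) (Ioo (-b) b) :=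
    iRR.add (iCC.const_mul _)
  have i2 : IntegrableOn (fun x ↦ 2 * (lam - R) * (C x * (F x - R * C x))) (Ioo (-b) b) := iRC.const_mul _
  have i3 : IntegrableOn (fun x ↦ (lam - R) ^ 2 * (C x * C x)) (Ioo (-b) b) := iCC.const_mul _
  rw [e, integral_sub i1 i2, integral_add iRR i3, integral_const_mul, integral_const_mul, horth, hCCw]
  ring

/-- **Every coupling budget bounds the residual energy**: `∫_{(−b,b)}(T_bC_b − R_cC_b)² ≤ ∫_{(−b,b)}(T_bC_b − λC_b)²` for all
real `λ` (`b > 0`). -/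
theorem setIntegral_residual_sq_le (hb : 0 < b) (lam : ℝ) :
    ∫ x in Ioo (-b) b, ((∑ n ∈ weilPrimeIndex b, (Λ n : ℝ) / Real.sqrt n *
        ((Icc (-b) b).indicator (fun y ↦ Real.cosh (y / 2)) (x - Real.log n)
          + (Icc (-b) b).indicator (fun y ↦ Real.cosh (y / 2)) (x + Real.log n)))
        - primeShiftForm b ((Icc (-b) b).indicator (fun y ↦ Real.cosh (y / 2))) / (b + Real.sinh b)
          * (Icc (-b) b).indicator (fun y ↦ Real.cosh (y / 2)) x) ^ 2
      ≤ ∫ x in Ioo (-b) b, ((∑ n ∈ weilPrimeIndex b, (Λ n : ℝ) / Real.sqrt n *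
          ((Icc (-b) b).indicator (fun y ↦ Real.cosh (y / 2)) (x - Real.log n)
            + (Icc (-b) b).indicator (fun y ↦ Real.cosh (y / 2)) (x + Real.log n)))
          - lam * (Icc (-b) b).indicator (fun y ↦ Real.cosh (y / 2)) x) ^ 2 := by
  rw [setIntegral_primeShiftOp_sub_sq_eq hb lam]
  have hP0 : 0 < b + Real.sinh b := by have := Real.sinh_pos_iff.2 hb; linarith
  nlinarith only [sq_nonneg (lam - primeShiftForm b ((Icc (-b) b).indicator (fun y ↦ Real.cosh (y / 2))) / (b + Real.sinh b)),
    hP0]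

/-! ## §2 The von Koch bound of the residual energy (RH) -/

/-- **Under RH the residual energy is `O(b⁵)·‖C_b‖²`**: `∃ K > 0, ∀ b ≥ 1, ∫_{(−b,b)}(T_bC_b − R_c(b)C_b)² ≤ K·b⁵·(b + sinh b)`
(`J(b) ≤ K b⁵`; stage-1 coupling at `λ = e^b + b` and projection minimality). -/
theorem residualEnergy_le_of_RH (hRH : RiemannHypothesis) :
    ∃ K : ℝ, 0 < K ∧ ∀ b : ℝ, 1 ≤ b →
      ∫ x in Ioo (-b) b, ((∑ n ∈ weilPrimeIndex b, (Λ n : ℝ) / Real.sqrt n *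
          ((Icc (-b) b).indicator (fun y ↦ Real.cosh (y / 2)) (x - Real.log n)
            + (Icc (-b) b).indicator (fun y ↦ Real.cosh (y / 2)) (x + Real.log n)))
          - primeShiftForm b ((Icc (-b) b).indicator (fun y ↦ Real.cosh (y / 2))) / (b + Real.sinh b)
            * (Icc (-b) b).indicator (fun y ↦ Real.cosh (y / 2)) x) ^ 2
        ≤ K * b ^ 5 * (b + Real.sinh b) := by
  obtain ⟨K, hK, h⟩ := integral_primeShiftOp_coshProfile_sub_sq_le_of_RH hRH
  refine ⟨K, hK, fun b hb ↦ ?_⟩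
  obtain ⟨-, hle⟩ := h b hb
  exact (setIntegral_residual_sq_le (by linarith) (Real.exp b + b)).trans hle

end FloorCoshSplit

end Summit.RiemannHypothesis.RiemannHypothesis.Theorems.WeilFormatC
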